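import Mathlib
import Summits.PneNP.PneNP.Theorems.ConvexRankGatesConvexGateBlindExactLiftingIndexRectanglesCore

/-!
# PneNP / ConvexRankGates — `ConvexGateBlind`, line `xor-door-perfect-completeness`:
# the Index-lift rectangle lemma (support of `stub_exactLifting`, lead c4)

Registered sub-goal `indexRect_card_mul_card_le` of crux item stmt-PneNP-10680 (line
`xor-door-perfect-completeness`, open stub `stub_exactLifting : XorDoor.ExactLifting`); vocabulary
and per-slice facts are in the sibling core file `…ExactLiftingIndexRectanglesCore.lean`.

**Rectangle lemma** (`indexRect_card_mul_card_le`; proved as `IndexRect.card_mul_card_le`).  Let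
`Z ⊆ 𝔽₂^m` contain no subcube of codimension `< κ` (`NoSubcube Z κ`: every partial assignment of
`< κ` coordinates extends to a point outside `Z`).  Then for every set `W` of pointer tuples, the set
`tables Z W` of tables `x` with `x[w] ∈ Z` for all `w ∈ W` satisfies
`#W · #(tables Z W) · t^κ ≤ 3^m · t^m · 2^{m t}`;
in words: a combinatorial rectangle of the `(m,t)`-Index lift on which the looked-up word stays in `Z`
has density at most `3^m · t^{-κ}` (`indexRect_rectangle_le`).  The exponent is sharp (the cylinder
`{w : w|_S = π} × {x : x_S[π] = α}` over a subcube `{z_S = α} ⊆ Z` of codimension `κ` has density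
`(2t)^{-κ}`).  It is elementary, `ε`-free and NOT a functional (hyperplane/corruption) bound: it is
the first lower-bound tool in the tree on the stub's own objects that jumps at the support.
Proof: induction on `m`, slicing off block `0`; a colouring `c = x 0 : Fin t → 𝔽₂` of the positions
of block `0` makes a reduced pointer `w̃` (slice set `S(w̃) = {a : (a, w̃) ∈ W}`, `#S(w̃) ≤ t`
copies in `W`) either BICHROMATIC — then `x̃[w̃]` is confined to `Z₀ ∩ Z₁`, which still has no
subcube of codimension `< κ`, and the induction hypothesis absorbs the factor `t` from the copies —
or MONOCHROMATIC — then only to a section `Z_b` (codimension parameter `κ - 1`, one factor `t`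
lost) but for only `2 · 2^{t - #S(w̃)}` colourings, and `2 #S · 2^{t-#S} ≤ 2^t`; the two charges
give the factor `3` per block.

**Consequence** (`indexRect_nmf_bound`): if a non-negative matrix on tables × pointers is supported
inside the lift of `Z` and is positive on a set `P` of entries, every non-negative factorisation
`M = ∑_{l<r} U_{x,l} V_{l,w}` has `#P · t^κ ≤ r · 3^m · t^m · 2^{mt}` (the `r` support rectangles
cover `P`).  Applied to `lift_t(viol_F) - J` — the `ε = 1`, unit-potential level of
`stub_exactLifting`, whose support is the lift of `{viol_F ≥ 2}` — this gives
`rk₊(lift_t(viol_F) - J) ≥ c_F · t^{κ_F}` with `κ_F` the least codimension of a subcube of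
`{viol_F ≥ 2}` (`= 5` for every cubic Tseitin system, e.g. K₄: `Θ(t⁵)` against
`rk₊(lift_t viol_F) ≤ #F · t³`); see the sibling file `…ExactLiftingUnitLevel.lean`.
-/

set_option linter.dupNamespace false -- `Summit.PneNP.PneNP.…`: summit = sub-problem (D-0017)

namespace Summit.PneNP.PneNP.Theorems.XorDoor

open scoped BigOperators Classical
open Finset

noncomputable section

namespace IndexRect

variable {m t : ℕ}

/-! ## §3 The rectangle lemma -/

/-- The trivial bound (used for `κ = 0`): `#W · #tables ≤ t^m · 2^{mt}`. -/
theorem card_mul_card_le_trivial (Z : Set (Fin m → ZMod 2)) (W : Finset (Fin m → Fin t)) :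
    W.card * (tables Z W).card ≤ t ^ m * 2 ^ (m * t) := by
  have hW : W.card ≤ t ^ m := by
    have := Finset.card_le_univ W
    simpa [Fintype.card_fun, Fintype.card_fin] using this
  have hT : (tables Z W).card ≤ 2 ^ (m * t) := by
    have := Finset.card_le_univ (tables Z W)
    simp only [Fintype.card_fun, Fintype.card_fin, ZMod.card] at this
    calc (tables Z W).card ≤ (2 ^ t) ^ m := this
      _ = 2 ^ (m * t) := by rw [← pow_mul, mul_comm]
  exact Nat.mul_le_mul hW hT

/-- **The Index-lift rectangle lemma.**  If `Z ⊆ 𝔽₂^m` contains no subcube of codimension `< κ`, then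
for every set `W` of pointer tuples, `#W · #(tables Z W) · t^κ ≤ 3^m · t^m · 2^{mt}`: a rectangle of
the `(m,t)`-Index lift on which the looked-up word stays in `Z` has density `≤ 3^m t^{-κ}`. -/
theorem card_mul_card_le (m : ℕ) :
    ∀ (t κ : ℕ) (Z : Set (Fin m → ZMod 2)) (W : Finset (Fin m → Fin t)),
      NoSubcube Z κ → W.card * (tables Z W).card * t ^ κ ≤ 3 ^ m * (t ^ m * 2 ^ (m * t)) := by
  induction m with
  | zero =>
    intro t κ Z W hZ
    rcases Nat.eq_zero_or_pos κ with rfl | hκ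
    · simpa using card_mul_card_le_trivial Z W
    · -- `κ ≥ 1`: the empty partial assignment extends outside `Z`, so `Z = ∅` in dimension `0`
      rcases W.eq_empty_or_nonempty with rfl | ⟨w, hw⟩
      · simp
      · obtain ⟨z, -, hz⟩ := hZ ∅ (by simpa using hκ) (fun i => 0)
        have hT : tables Z W = ∅ := by
          apply Finset.eq_empty_of_forall_notMem
          intro x hx
          simp only [tables, Finset.mem_filter, Finset.mem_univ, true_and] at hx
          apply hz
          have : lookup x w = z := funext fun i => Fin.elim0 i
          rw [← this]; exact hx w hw
        simp [hT]
  | succ m ih =>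
    intro t κ Z W hZ
    rcases Nat.eq_zero_or_pos κ with rfl | hκ
    · simpa using (card_mul_card_le_trivial Z W).trans (Nat.le_mul_of_pos_left _ (by positivity))
    obtain ⟨k, rfl⟩ : ∃ k, κ = k + 1 := ⟨κ - 1, by omega⟩
    -- the two induction hypotheses, uniformly in the colouring `c`
    set K : ℕ := 3 ^ m * (t ^ m * 2 ^ (m * t)) with hK
    have hbi : ∀ c : Fin t → ZMod 2,
        (biSet W c).card * (tabT Z W c).card * t ^ (k + 1) ≤ K := fun c =>
      calc (biSet W c).card * (tabT Z W c).card * t ^ (k + 1)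
          ≤ (biSet W c).card * (tables (sec Z 0 ∩ sec Z 1) (biSet W c)).card * t ^ (k + 1) := by
            gcongr; exact tabT_subset_bi Z W c
        _ ≤ K := ih t (k + 1) _ _ (noSubcube_inter Z hZ)
    have hcol : ∀ (c : Fin t → ZMod 2) (b : ZMod 2),
        (colSet W c b).card * (tabT Z W c).card * t ^ k ≤ K := fun c b =>
      calc (colSet W c b).card * (tabT Z W c).card * t ^ k
          ≤ (colSet W c b).card * (tables (sec Z b) (colSet W c b)).card * t ^ k := by
            gcongr; exact tabT_subset_col Z W c b
        _ ≤ K := ih t k _ _ (noSubcube_sec Z hZ b)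
    have hlive : ∀ c : Fin t → ZMod 2, (live W).card * (tabT Z W c).card * t ^ k ≤ 2 * K := fun c =>
      calc (live W).card * (tabT Z W c).card * t ^ k
          ≤ ((colSet W c 0).card + (colSet W c 1).card) * (tabT Z W c).card * t ^ k := by
            gcongr
            exact (Finset.card_le_card (live_subset_col W c)).trans (Finset.card_union_le _ _)
        _ = (colSet W c 0).card * (tabT Z W c).card * t ^ k
            + (colSet W c 1).card * (tabT Z W c).card * t ^ k := by ring
        _ ≤ K + K := Nat.add_le_add (hcol c 0) (hcol c 1)
        _ = 2 * K := by ring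
    -- split `#W = ∑ #S(w̃)` into bichromatic and monochromatic reduced pointers, per colouring
    have hsplit : ∀ c : Fin t → ZMod 2, W.card =
        (∑ w' ∈ biSet W c, (slices W w').card)
        + ∑ w' ∈ univ.filter (fun w' => w' ∉ biSet W c), (slices W w').card := by
      intro c
      rw [card_eq_sum_slices, ← Finset.sum_filter_add_sum_filter_not univ (fun w' => w' ∈ biSet W c)
        (fun w' => (slices W w').card)]
      congr 1
      rw [Finset.filter_univ_mem]
    -- (A) the bichromatic part, per colouring
    have hA : ∀ c : Fin t → ZMod 2,
        (∑ w' ∈ biSet W c, (slices W w').card) * (tabT Z W c).card * t ^ (k + 1) ≤ t * K := by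
      intro c
      have hs : ∑ w' ∈ biSet W c, (slices W w').card ≤ t * (biSet W c).card := by
        calc ∑ w' ∈ biSet W c, (slices W w').card ≤ ∑ _w' ∈ biSet W c, t :=
              Finset.sum_le_sum fun w' _ => by simpa using Finset.card_le_univ (slices W w')
          _ = t * (biSet W c).card := by rw [Finset.sum_const, smul_eq_mul, mul_comm]
      calc (∑ w' ∈ biSet W c, (slices W w').card) * (tabT Z W c).card * t ^ (k + 1)
          ≤ (t * (biSet W c).card) * (tabT Z W c).card * t ^ (k + 1) := by gcongr
        _ = t * ((biSet W c).card * (tabT Z W c).card * t ^ (k + 1)) := by ring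
        _ ≤ t * K := Nat.mul_le_mul_left _ (hbi c)
    -- (B) the monochromatic part: per colouring, multiplied by `#live`
    have hBc : ∀ c : Fin t → ZMod 2,
        (live W).card * ((∑ w' ∈ univ.filter (fun w' => w' ∉ biSet W c), (slices W w').card)
          * (tabT Z W c).card * t ^ (k + 1))
        ≤ (∑ w' ∈ univ.filter (fun w' => w' ∉ biSet W c), (slices W w').card) * (t * (2 * K)) := by
      intro c
      have hl := hlive c
      calc (live W).card * ((∑ w' ∈ univ.filter (fun w' => w' ∉ biSet W c), (slices W w').card)
            * (tabT Z W c).card * t ^ (k + 1))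
          = (∑ w' ∈ univ.filter (fun w' => w' ∉ biSet W c), (slices W w').card)
              * (t * ((live W).card * (tabT Z W c).card * t ^ k)) := by ring
        _ ≤ (∑ w' ∈ univ.filter (fun w' => w' ∉ biSet W c), (slices W w').card) * (t * (2 * K)) :=
            Nat.mul_le_mul_left _ (Nat.mul_le_mul_left _ hl)
    have hB : (live W).card * ∑ c : Fin t → ZMod 2,
        (∑ w' ∈ univ.filter (fun w' => w' ∉ biSet W c), (slices W w').card)
          * (tabT Z W c).card * t ^ (k + 1) ≤ (live W).card * (2 * t * K * 2 ^ t) := by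
      rw [Finset.mul_sum]
      calc ∑ c : Fin t → ZMod 2, (live W).card *
              ((∑ w' ∈ univ.filter (fun w' => w' ∉ biSet W c), (slices W w').card)
                * (tabT Z W c).card * t ^ (k + 1))
          ≤ ∑ c : Fin t → ZMod 2,
              (∑ w' ∈ univ.filter (fun w' => w' ∉ biSet W c), (slices W w').card) * (t * (2 * K)) :=
            Finset.sum_le_sum fun c _ => hBc c
        _ = (∑ c : Fin t → ZMod 2,
              ∑ w' ∈ univ.filter (fun w' => w' ∉ biSet W c), (slices W w').card) * (t * (2 * K)) := by
            rw [Finset.sum_mul]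
        _ ≤ ((live W).card * 2 ^ t) * (t * (2 * K)) := Nat.mul_le_mul_right _ (sum_mono_le W)
        _ = (live W).card * (2 * t * K * 2 ^ t) := by ring
    -- assemble
    rcases Nat.eq_zero_or_pos (live W).card with hl | hl
    · -- no live reduced pointer: `W = ∅`
      have hW : W.card = 0 := by
        rw [card_eq_sum_slices]
        apply Finset.sum_eq_zero
        intro w' _
        have : w' ∉ live W := by
          intro h; rw [Finset.card_eq_zero] at hl; simp [hl] at h
        simp only [live, Finset.mem_filter, Finset.mem_univ, true_and, Finset.not_nonempty_iff_eq_empty] at this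
        simp [this]
      simp [hW]
    have hB' : ∑ c : Fin t → ZMod 2,
        (∑ w' ∈ univ.filter (fun w' => w' ∉ biSet W c), (slices W w').card)
          * (tabT Z W c).card * t ^ (k + 1) ≤ 2 * t * K * 2 ^ t := Nat.le_of_mul_le_mul_left hB hl
    calc W.card * (tables Z W).card * t ^ (k + 1)
        = ∑ c : Fin t → ZMod 2, W.card * (tabT Z W c).card * t ^ (k + 1) := by
          rw [card_tables_eq_sum, Finset.mul_sum, Finset.sum_mul]
      _ = ∑ c : Fin t → ZMod 2, ((∑ w' ∈ biSet W c, (slices W w').card) * (tabT Z W c).card * t ^ (k + 1)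
            + (∑ w' ∈ univ.filter (fun w' => w' ∉ biSet W c), (slices W w').card)
              * (tabT Z W c).card * t ^ (k + 1)) := by
          refine Finset.sum_congr rfl fun c _ => ?_
          conv_lhs => rw [hsplit c]
          ring
      _ = (∑ c : Fin t → ZMod 2, (∑ w' ∈ biSet W c, (slices W w').card) * (tabT Z W c).card * t ^ (k + 1))
            + ∑ c : Fin t → ZMod 2, (∑ w' ∈ univ.filter (fun w' => w' ∉ biSet W c), (slices W w').card)
              * (tabT Z W c).card * t ^ (k + 1) := Finset.sum_add_distrib
      _ ≤ (∑ _c : Fin t → ZMod 2, t * K) + 2 * t * K * 2 ^ t :=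
          Nat.add_le_add (Finset.sum_le_sum fun c _ => hA c) hB'
      _ = 3 ^ (m + 1) * (t ^ (m + 1) * 2 ^ ((m + 1) * t)) := by
          rw [Finset.sum_const, smul_eq_mul, Finset.card_univ, Fintype.card_fun, Fintype.card_fin, ZMod.card,
            hK]
          ring

/-- Rectangle form: if `x[w] ∈ Z` on the whole rectangle `X × W`, then `#X · #W · t^κ ≤ 3^m t^m 2^{mt}`. -/
theorem indexRect_rectangle_le {κ : ℕ} (Z : Set (Fin m → ZMod 2)) (hZ : NoSubcube Z κ)
    (X : Finset (Fin m → Fin t → ZMod 2)) (W : Finset (Fin m → Fin t))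
    (hXW : ∀ x ∈ X, ∀ w ∈ W, lookup x w ∈ Z) :
    X.card * W.card * t ^ κ ≤ 3 ^ m * (t ^ m * 2 ^ (m * t)) := by
  have hsub : X ⊆ tables Z W := by
    intro x hx
    simp only [tables, Finset.mem_filter, Finset.mem_univ, true_and]
    exact hXW x hx
  calc X.card * W.card * t ^ κ = W.card * X.card * t ^ κ := by ring
    _ ≤ W.card * (tables Z W).card * t ^ κ := by gcongr
    _ ≤ _ := card_mul_card_le m t κ Z W hZ

/-! ## §4 Consequence for non-negative factorisations supported in a lift -/

/-- **Cover-number bound for non-negative factorisations.**  Let `M ≥ 0` be a matrix on tables ×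
pointers whose support lies inside the lift of `Z` (`M x w ≠ 0 → x[w] ∈ Z`), `Z` without subcubes of
codimension `< κ`, and let `P` be a set of entries on which `M` is positive.  Then every non-negative
factorisation `M = ∑_{l<r} U_{·,l} ⊗ V_{l,·}` has `#P · t^κ ≤ r · 3^m · t^m · 2^{mt}` (the `r` support
rectangles `{U_{·,l} > 0} × {V_{l,·} > 0}` cover `P` and each obeys the rectangle lemma). -/
theorem indexRect_nmf_bound {κ r : ℕ} (Z : Set (Fin m → ZMod 2)) (hZ : NoSubcube Z κ)
    (M : (Fin m → Fin t → ZMod 2) → (Fin m → Fin t) → ℝ)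
    (hsupp : ∀ x w, M x w ≠ 0 → lookup x w ∈ Z)
    (U : (Fin m → Fin t → ZMod 2) → Fin r → ℝ) (V : Fin r → (Fin m → Fin t) → ℝ)
    (hU : ∀ x l, 0 ≤ U x l) (hV : ∀ l w, 0 ≤ V l w)
    (hM : ∀ x w, M x w = ∑ l, U x l * V l w)
    (P : Finset ((Fin m → Fin t → ZMod 2) × (Fin m → Fin t))) (hP : ∀ p ∈ P, 0 < M p.1 p.2) :
    P.card * t ^ κ ≤ r * (3 ^ m * (t ^ m * 2 ^ (m * t))) := by
  -- the support rectangles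
  let X : Fin r → Finset (Fin m → Fin t → ZMod 2) := fun l => univ.filter fun x => 0 < U x l
  let Y : Fin r → Finset (Fin m → Fin t) := fun l => univ.filter fun w => 0 < V l w
  have hrect : ∀ l, (X l).card * (Y l).card * t ^ κ ≤ 3 ^ m * (t ^ m * 2 ^ (m * t)) := by
    intro l
    refine indexRect_rectangle_le Z hZ (X l) (Y l) fun x hx w hw => hsupp x w ?_
    simp only [X, Y, Finset.mem_filter, Finset.mem_univ, true_and] at hx hw
    rw [hM x w]
    have : 0 < ∑ l', U x l' * V l' w :=
      lt_of_lt_of_le (mul_pos hx hw) (Finset.single_le_sum (fun l' _ => mul_nonneg (hU x l') (hV l' w))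
        (Finset.mem_univ l))
    exact this.ne'
  -- every positive entry lies in some support rectangle
  have hcover : P ⊆ Finset.univ.biUnion fun l => X l ×ˢ Y l := by
    intro p hp
    have hpos := hP p hp
    rw [hM] at hpos
    have hlt : ∑ _l : Fin r, (0 : ℝ) < ∑ l, U p.1 l * V l p.2 := by simpa using hpos
    obtain ⟨l, -, hl⟩ := Finset.exists_lt_of_sum_lt hlt
    have hUl : 0 < U p.1 l :=
      lt_of_le_of_ne (hU p.1 l) fun h => by rw [← h, zero_mul] at hl; exact lt_irrefl _ hl
    have hVl : 0 < V l p.2 :=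
      lt_of_le_of_ne (hV l p.2) fun h => by rw [← h, mul_zero] at hl; exact lt_irrefl _ hl
    simp only [Finset.mem_biUnion, Finset.mem_univ, true_and, Finset.mem_product]
    refine ⟨l, ?_, ?_⟩
    · simp only [X, Finset.mem_filter, Finset.mem_univ, true_and]; exact hUl
    · simp only [Y, Finset.mem_filter, Finset.mem_univ, true_and]; exact hVl
  calc P.card * t ^ κ ≤ (Finset.univ.biUnion fun l => X l ×ˢ Y l).card * t ^ κ :=
        Nat.mul_le_mul_right _ (Finset.card_le_card hcover)
    _ ≤ (∑ l, (X l ×ˢ Y l).card) * t ^ κ := Nat.mul_le_mul_right _ Finset.card_biUnion_le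
    _ = ∑ l, (X l).card * (Y l).card * t ^ κ := by
        rw [Finset.sum_mul]; refine Finset.sum_congr rfl fun l _ => ?_; rw [Finset.card_product]
    _ ≤ ∑ _l : Fin r, 3 ^ m * (t ^ m * 2 ^ (m * t)) := Finset.sum_le_sum fun l _ => hrect l
    _ = r * (3 ^ m * (t ^ m * 2 ^ (m * t))) := by simp

end IndexRect

/-- **Registered sub-goal `indexRect_card_mul_card_le` of stmt-PneNP-10680** (the Index-lift rectangle
lemma, by name): if `Z ⊆ 𝔽₂^m` contains no subcube of codimension `< κ`, then for every set `W` of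
pointer tuples `#W · #(tables Z W) · t^κ ≤ 3^m · t^m · 2^{mt}`. -/
theorem indexRect_card_mul_card_le :
    ∀ (m t κ : ℕ) (Z : Set (Fin m → ZMod 2)) (W : Finset (Fin m → Fin t)),
      IndexRect.NoSubcube Z κ → W.card * (IndexRect.tables Z W).card * t ^ κ ≤ 3 ^ m * (t ^ m * 2 ^ (m * t)) :=
  IndexRect.card_mul_card_le

end

end Summit.PneNP.PneNP.Theorems.XorDoor
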